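import Summits.AtomisticToContinuum.HydrodynamicLimit.Theorems.UGibbsSRBRigidityTemperedCollisionsRung0
import Summits.AtomisticToContinuum.HydrodynamicLimit.Theses.UGibbsSRBRigidity
import Summits.AtomisticToContinuum.HydrodynamicLimit.Theorems.JParityClosureCollisionTightnessDomination
import HarnessLib

/-!
# `UGibbsSRBRigidity.TemperedCollisions` (stmt-AtomisticToContinuum-9391):
# the reduction to an N-uniform pair-correlation bound along the evolved law; finiteness for each `N`

Helper file (`--supports stmt-AtomisticToContinuum-9391`).

* `temperedCollisions_of_pairCorrelationBound` — **the conditional theorem**: IF along the hard-sphere flow started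
  from the local Gibbs law the means of pair functionals `Σ_{p≠q} g(x_p − x_q, v_p − v_q)` with `∫ g(y − c, u) dy ≤ B`
  stay `≤ K (N+1)² B` uniformly in `N` and in time (an N-uniform bound on the two-particle function of the evolved
  law tested against relative-position profiles — the sharp form of the route's foreseen child
  `ContactDensityBound`; it holds at rung 0 with `K = 2`), THEN the route decl
  `UGibbsSRBRigidity.TemperedCollisions` holds with `C = 2π K σ²` (steps 1–4 are law-free).
* `lintegral_temperedSum_lt_top` — for every `N` the item's expectation is FINITE under any continuous positive
  profiles (domination of the local Gibbs law by a homogeneous one, `exists_localGibbsMeasure_le_smul_const`, times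
  rung 0); the loss `Λ^{N+1}` — the measure form of `H(local Gibbs | Gibbs) = O(N)` — is why this does not settle
  the item: the mark `1/|w_n|` has no exponential flux moment and the contact structure of the evolved law is
  invisible to entropy.

References: H. Spohn (1991), Part I §2.3–§3; C. Kipnis, C. Landim (1999), App. 1.8.
-/

noncomputable section

open MeasureTheory Set Filter Topology
open scoped ENNReal InnerProductSpace

namespace Summit.AtomisticToContinuum.HydrodynamicLimit.Theorems

open Literature.Analysis.FluidPDE Literature.MathematicalPhysics.KineticTheory
open Literature.Analysis.FunctionSpaces

/-! ### The reduction of the item to a pair-correlation bound along the evolved law; finiteness for each `N` -/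

/-- **`TemperedCollisions` from an N-uniform pair-correlation bound along the evolved local Gibbs law** (the
law-free reduction `lintegral_temperedSum_le_liminf`, closed up).  HYPOTHESIS (conjecture-grade, the sharp form of
the route's foreseen child `ContactDensityBound`; at rung 0 it holds with `K = 2` by `lintegral_pairSum_le` and
flow-invariance): for all continuous positive profiles there is `σ₀` such that for `0 < σ < σ₀` there is a finite
`K` with, for all `N`, all flows `Φ`, all times `s ≥ 0` and EVERY jointly measurable weight `g(y, u) ≥ 0` of a
relative torus position and a relative velocity whose Haar integral in `y` is at most `B` whatever `u` and the
centre, `E_{λ_N}[Σ_{p ≠ q} g(x_p(s) − x_q(s), v_p(s) − v_q(s))] ≤ K (N+1)² B` along the hard-sphere flow started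
from the local Gibbs law `λ_N` — i.e. the two-particle function of the evolved law, conditionally on the two
velocities and integrated over a relative-position profile, never exceeds `K ×` its product (Haar) benchmark,
uniformly in `N` and `s`.  CONCLUSION: `UGibbsSRBRigidity.TemperedCollisions`, with `C = 2π K σ²` (the window
functional of `exists_temperedSum_majorant` at window length `h` has benchmark `B = 2π ε_N² h`, the windows tile
`[0, t + 1]`, and `(N+1)² ε_N² = σ² (N+1)^{4/3}`). [folklore] -/
theorem temperedCollisions_of_pairCorrelationBound
    (H : ∀ (a₀ θ₀ : T3 → ℝ) (u₀ : T3 → V3), Continuous a₀ → Continuous θ₀ → Continuous u₀ →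
      (∀ x, 0 < a₀ x) → (∀ x, 0 < θ₀ x) → ∃ σ₀ : ℝ, 0 < σ₀ ∧ ∀ σ : ℝ, 0 < σ → σ < σ₀ →
        ∃ K : ℝ≥0∞, K ≠ ⊤ ∧ ∀ (N : ℕ)
          (Φ : HardSphereFlow (Torus.geometry (Fin 3)) (hsDiameter σ N) (N + 1)) (s : ℝ), 0 ≤ s →
          ∀ (g : T3 → V3 → ℝ≥0∞) (B : ℝ≥0∞), Measurable (Function.uncurry g) →
            (∀ (c : T3) (u : V3), ∫⁻ y, g (y - c) u ≤ B) →
            ∫⁻ z, ∑ p : Fin (N + 1), ∑ q ∈ Finset.univ.erase p,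
                g ((Φ.flow s z p).1 - (Φ.flow s z q).1) ((Φ.flow s z p).2 - (Φ.flow s z q).2)
              ∂(localGibbsLaw σ a₀ u₀ θ₀ N Φ) ≤ K * ((N : ℝ≥0∞) + 1) ^ 2 * B) :
    Summit.AtomisticToContinuum.HydrodynamicLimit.Theses.UGibbsSRBRigidity.TemperedCollisions := by
  intro a₀ θ₀ u₀ ha hθ hu ha0 hθ0
  obtain ⟨σ₀, hσ₀, hσ⟩ := H a₀ θ₀ u₀ ha hθ hu ha0 hθ0
  refine ⟨σ₀, hσ₀, fun σ hσpos hσlt => ?_⟩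
  obtain ⟨K, hKtop, hK⟩ := hσ σ hσpos hσlt
  refine ⟨2 * Real.pi * K.toReal * σ ^ 2, fun t ht N Φ => ?_⟩
  have hε0 : 0 < hsDiameter σ N := hsDiameter_pos hσpos N
  set P := localGibbsLaw σ a₀ u₀ θ₀ N Φ with hP
  have hgood0 : P Φ.goodᶜ = 0 := by
    rw [hP, localGibbsLaw_eq]
    exact localGibbsMeasure_absolutelyContinuous σ _ _ _ N Φ Φ.measure_compl_good
  have hgood : ∀ᵐ z ∂P, z ∈ Φ.good := ae_iff.2 hgood0
  -- monotonicity in the horizon, then the law-free reduction at the horizon `t + 1`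
  have hτ : 0 < t + 1 := by linarith
  obtain ⟨g, hgm, hgint, hle⟩ := lintegral_temperedSum_le_liminf hε0 Φ hτ P hgood0
  set R : ℝ≥0∞ := K * ((N : ℝ≥0∞) + 1) ^ 2 * ENNReal.ofReal (2 * Real.pi * hsDiameter σ N ^ 2 * (t + 1))
    with hR
  have hmean : ∀ m : ℕ, ∑ k ∈ Finset.range (2 ^ m),
      ∫⁻ z, ∑ p : Fin (N + 1), ∑ q ∈ Finset.univ.erase p,
        g m ((Φ.flow (k * ((t + 1) / 2 ^ m)) z p).1 - (Φ.flow (k * ((t + 1) / 2 ^ m)) z q).1)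
          ((Φ.flow (k * ((t + 1) / 2 ^ m)) z p).2 - (Φ.flow (k * ((t + 1) / 2 ^ m)) z q).2) ∂P ≤ R := by
    intro m
    have hk : ∀ k ∈ Finset.range (2 ^ m),
        ∫⁻ z, ∑ p : Fin (N + 1), ∑ q ∈ Finset.univ.erase p,
          g m ((Φ.flow (k * ((t + 1) / 2 ^ m)) z p).1 - (Φ.flow (k * ((t + 1) / 2 ^ m)) z q).1)
            ((Φ.flow (k * ((t + 1) / 2 ^ m)) z p).2 - (Φ.flow (k * ((t + 1) / 2 ^ m)) z q).2) ∂P ≤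
          K * ((N : ℝ≥0∞) + 1) ^ 2 * ENNReal.ofReal (2 * Real.pi * hsDiameter σ N ^ 2 * ((t + 1) / 2 ^ m)) :=
      fun k _ => hK N Φ _ (by positivity) (g m) _ (hgm m) (hgint m)
    calc ∑ k ∈ Finset.range (2 ^ m), ∫⁻ z, ∑ p : Fin (N + 1), ∑ q ∈ Finset.univ.erase p,
          g m ((Φ.flow (k * ((t + 1) / 2 ^ m)) z p).1 - (Φ.flow (k * ((t + 1) / 2 ^ m)) z q).1)
            ((Φ.flow (k * ((t + 1) / 2 ^ m)) z p).2 - (Φ.flow (k * ((t + 1) / 2 ^ m)) z q).2) ∂P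
        ≤ ∑ _k ∈ Finset.range (2 ^ m),
            K * ((N : ℝ≥0∞) + 1) ^ 2 * ENNReal.ofReal (2 * Real.pi * hsDiameter σ N ^ 2 * ((t + 1) / 2 ^ m)) :=
          Finset.sum_le_sum hk
      _ = R := by
          rw [Finset.sum_const, Finset.card_range, nsmul_eq_mul]
          have h2 : ((2 ^ m : ℕ) : ℝ≥0∞) = ENNReal.ofReal ((2 : ℝ) ^ m) := by
            rw [ENNReal.ofReal_pow (by norm_num), ENNReal.ofReal_ofNat, Nat.cast_pow, Nat.cast_ofNat]
          have hprod : ((2 ^ m : ℕ) : ℝ≥0∞) *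
              ENNReal.ofReal (2 * Real.pi * hsDiameter σ N ^ 2 * ((t + 1) / 2 ^ m)) =
              ENNReal.ofReal (2 * Real.pi * hsDiameter σ N ^ 2 * (t + 1)) := by
            rw [h2, ← ENNReal.ofReal_mul (by positivity)]
            congr 1
            field_simp
          calc ((2 ^ m : ℕ) : ℝ≥0∞) * (K * ((N : ℝ≥0∞) + 1) ^ 2 *
                ENNReal.ofReal (2 * Real.pi * hsDiameter σ N ^ 2 * ((t + 1) / 2 ^ m)))
              = K * ((N : ℝ≥0∞) + 1) ^ 2 * (((2 ^ m : ℕ) : ℝ≥0∞) *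
                  ENNReal.ofReal (2 * Real.pi * hsDiameter σ N ^ 2 * ((t + 1) / 2 ^ m))) := by ring
            _ = R := by rw [hprod]
  have hbound : ∫⁻ z, ENNReal.ofReal (∑ᶠ τ ∈ collisionTimes (Torus.geometry (Fin 3)) (hsDiameter σ N)
        (fun s => Φ.flow s z) ∩ Icc 0 (t + 1),
      ∑ p : Fin (N + 1), ∑ q ∈ Finset.univ.erase p,
        (contactSet (Torus.geometry (Fin 3)) (N + 1) (hsDiameter σ N) p q).indicator
          (fun y : Config (N + 1) (Fin 3) T3 =>
            hsDiameter σ N / |⟪(Torus.geometry (Fin 3)).sepVec (y p).1 (y q).1, (y p).2 - (y q).2⟫_ℝ|)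
          (Φ.flow τ z)) ∂P ≤ R :=
    hle.trans (liminf_le_of_frequently_le (Eventually.of_forall hmean).frequently)
  refine le_trans (lintegral_mono_ae ?_) (hbound.trans ?_)
  · filter_upwards [hgood] with z hz
    exact ENNReal.ofReal_le_ofReal (temperedSum_mono hε0.le Φ hz (by linarith))
  · -- `R = ofReal (C (1 + t) (N+1)^{4/3})`
    have hsc := succ_sq_mul_hsDiameter_sq σ N
    have hN : ((N : ℝ≥0∞) + 1) ^ 2 = ENNReal.ofReal (((N : ℝ) + 1) ^ 2) := by
      rw [ENNReal.ofReal_pow (by positivity), ENNReal.ofReal_add (by positivity) zero_le_one,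
        ENNReal.ofReal_natCast, ENNReal.ofReal_one]
    conv_lhs => rw [hR, ← ENNReal.ofReal_toReal hKtop, hN, ← ENNReal.ofReal_mul ENNReal.toReal_nonneg,
      ← ENNReal.ofReal_mul (by positivity)]
    refine ENNReal.ofReal_le_ofReal (le_of_eq ?_)
    calc K.toReal * ((N : ℝ) + 1) ^ 2 * (2 * Real.pi * hsDiameter σ N ^ 2 * (t + 1))
        = 2 * Real.pi * K.toReal * (((N : ℝ) + 1) ^ 2 * hsDiameter σ N ^ 2) * (1 + t) := by ring
      _ = 2 * Real.pi * K.toReal * σ ^ 2 * (1 + t) * ((N : ℝ) + 1) ^ (4 / 3 : ℝ) := by rw [hsc]; ring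

/-- **The tempered collision sum has a finite mean for every `N`** (not uniformly): for continuous positive
profiles, `0 < σ ≤ 1/4`, every `N`, flow and `t ≥ 0`, the local Gibbs expectation of the item's collision
functional over `[0, t]` is at most `Λ^{N+1} · 4π (N+1)² ε_N² (t + 1) < ∞`, by domination of the local Gibbs law by
a homogeneous one (`exists_localGibbsMeasure_le_smul_const`, the measure form of `H(local Gibbs | Gibbs) = O(N)`)
and rung 0 (`lintegral_temperedSum_le_const`).  The exponential loss `Λ^{N+1}` is why this transfer does not
settle the item. [folklore] -/
theorem lintegral_temperedSum_lt_top {a₀ θ₀ : T3 → ℝ} {u₀ : T3 → V3} (ha : Continuous a₀) (hθ : Continuous θ₀)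
    (hu : Continuous u₀) (ha0 : ∀ x, 0 < a₀ x) (hθ0 : ∀ x, 0 < θ₀ x) {σ : ℝ} (hσ : 0 < σ) (hσ4 : σ ≤ 1 / 4)
    (N : ℕ) (Φ : HardSphereFlow (Torus.geometry (Fin 3)) (hsDiameter σ N) (N + 1)) {t : ℝ} (ht : 0 ≤ t) :
    ∫⁻ z, ENNReal.ofReal (∑ᶠ τ ∈ collisionTimes (Torus.geometry (Fin 3)) (hsDiameter σ N)
          (fun s => Φ.flow s z) ∩ Icc 0 t,
        ∑ p : Fin (N + 1), ∑ q ∈ Finset.univ.erase p,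
          (contactSet (Torus.geometry (Fin 3)) (N + 1) (hsDiameter σ N) p q).indicator
            (fun y : Config (N + 1) (Fin 3) T3 =>
              hsDiameter σ N / |⟪(Torus.geometry (Fin 3)).sepVec (y p).1 (y q).1, (y p).2 - (y q).2⟫_ℝ|)
            (Φ.flow τ z)) ∂(localGibbsLaw σ a₀ u₀ θ₀ N Φ) < ⊤ := by
  obtain ⟨θ₁, hθ₁, Λ, hΛ, hdom⟩ := exists_localGibbsMeasure_le_smul_const ha hθ hu ha0 hθ0
  have hσ2 : σ ≤ 1 / 2 := hσ4.trans (by norm_num)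
  have hle := hdom σ hσ2 N
  have hε0 : 0 < hsDiameter σ N := hsDiameter_pos hσ N
  have hrung0 := lintegral_temperedSum_le_const one_pos hθ₁ (0 : V3) hσ hσ4 N Φ (τ := t + 1) (by linarith)
  rw [localGibbsLaw_eq] at hrung0 ⊢
  have hgood : ∀ᵐ z ∂localGibbsMeasure σ a₀ u₀ θ₀ N, z ∈ Φ.good :=
    ae_iff.2 (localGibbsMeasure_absolutelyContinuous σ _ _ _ N Φ Φ.measure_compl_good)
  refine lt_of_le_of_lt (lintegral_mono_ae (hgood.mono fun z hz =>
    ENNReal.ofReal_le_ofReal (temperedSum_mono hε0.le Φ hz (by linarith : t ≤ t + 1)))) ?_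
  refine lt_of_le_of_lt (lintegral_mono' hle le_rfl) ?_
  rw [lintegral_smul_measure]
  refine ENNReal.mul_lt_top ENNReal.ofReal_lt_top (lt_of_le_of_lt hrung0 ENNReal.ofReal_lt_top)


end Summit.AtomisticToContinuum.HydrodynamicLimit.Theorems

end
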